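import Mathlib.Analysis.SpecialFunctions.SmoothTransition
import Mathlib.Analysis.SpecialFunctions.Exp
import Mathlib.Analysis.SpecialFunctions.Trigonometric.Series
import Mathlib.Analysis.Calculus.Deriv.Basic

/-!
# Crux `AdiabaticMultiKerrILED` (line `Sketch`) — the explicit slope bound `|smoothTransition′| ≤ 4`

Helper file for the crux `stmt-FinalStateConjecture-14310`
(`Summit.FinalStateConjecture.FinalStateConjecture.Theses.ClusterCompleteness.AdiabaticMultiKerrILED`),
line `Sketch`, stub `abs_deriv_smoothTransition_le_four` (lead c7, wave 1).

The tails-cut Kerr zones of the crux are glued into flat space with the cut-off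
`χ(r) = Real.smoothTransition (2 − r/(8M))`; the photon-sphere uniqueness of the tails-cut metric and the
Morawetz positivity on the annulus `8M ≤ r ≤ 16M` consume an EXPLICIT bound on the slope of Mathlib's
smooth transition `S = Real.smoothTransition`. This file proves `|S′ x| ≤ 4` for every real `x`
(`abs_deriv_smoothTransition_le_four`; the true supremum is `2`, attained at `x = 1/2`).

Proof (Mathlib only). With `g = expNegInvGlue` (`g x = exp (−1/x)` for `x > 0`, `0` for `x ≤ 0`,
`g′ = x⁻² g` on all of `ℝ`), `S = g x / (g x + g (1 − x))` has the closed-form derivative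
`S′ x = g x · g (1−x) · (x⁻² + (1−x)⁻²) / (g x + g (1−x))²` on all of `ℝ`; it vanishes off `(0, 1)` and is
nonnegative. On `(0, 1)` put `a = 1/x`, `b = 1/(1−x)` (so `ab = a + b`), `A = e^{−a}`, `B = e^{−b}`:
`S′ = AB(a² + b²)/(A + B)²`, and `A² + B² = AB(e^{b−a} + e^{a−b}) ≥ AB(2 + (a−b)²)` (two terms of the
`cosh` series) reduces `AB(a² + b²) ≤ 2(A + B)²` to `(a − 2)² + (b − 2)² ≥ 0`. Hence `0 ≤ S′ ≤ 2 ≤ 4`.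
(The same computation exists in the tree as
`Literature.NumberTheory.Sieve.GreenTao2008.deriv_smoothTransition_le_two`; it is re-derived here with
private helpers so that the crux's import closure stays inside Mathlib's special functions.) [folklore]
-/

noncomputable section

-- the doubled `FinalStateConjecture.FinalStateConjecture` path component trips dupNamespace
set_option linter.dupNamespace false

open Polynomial

namespace Summit.FinalStateConjecture.FinalStateConjecture.Theorems

/-- `g′ = x⁻² · g` for `g = expNegInvGlue`, at every real `x` (Mathlib's
`expNegInvGlue.hasDerivAt_polynomial_eval_inv_mul` with the constant polynomial `1`). [folklore] -/
private theorem hasDerivAt_expNegInvGlue (x : ℝ) :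
    HasDerivAt expNegInvGlue (x⁻¹ ^ 2 * expNegInvGlue x) x := by
  have h := expNegInvGlue.hasDerivAt_polynomial_eval_inv_mul 1 x
  simpa using h

/-- The derivative of Mathlib's smooth transition in closed form, valid on all of `ℝ`:
`S′ x = g x · g (1 − x) · (x⁻² + (1 − x)⁻²) / (g x + g (1 − x))²`, `g = expNegInvGlue`.
(Adapted from `Literature.NumberTheory.Sieve.GreenTao2008.hasDerivAt_smoothTransition`.) [folklore] -/
private theorem hasDerivAt_smoothTransition (x : ℝ) :
    HasDerivAt Real.smoothTransition
      (expNegInvGlue x * expNegInvGlue (1 - x) * (x⁻¹ ^ 2 + (1 - x)⁻¹ ^ 2) /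
        (expNegInvGlue x + expNegInvGlue (1 - x)) ^ 2) x := by
  have hsub : HasDerivAt (fun y : ℝ => 1 - y) (-1) x := (hasDerivAt_id' x).const_sub 1
  have h1 : HasDerivAt (fun y => expNegInvGlue (1 - y))
      ((1 - x)⁻¹ ^ 2 * expNegInvGlue (1 - x) * -1) x :=
    (hasDerivAt_expNegInvGlue (1 - x)).comp x hsub
  have hden : HasDerivAt (fun y => expNegInvGlue y + expNegInvGlue (1 - y))
      (x⁻¹ ^ 2 * expNegInvGlue x + (1 - x)⁻¹ ^ 2 * expNegInvGlue (1 - x) * -1) x :=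
    (hasDerivAt_expNegInvGlue x).add h1
  have hpos := Real.smoothTransition.pos_denom x
  have hq : HasDerivAt Real.smoothTransition
      ((x⁻¹ ^ 2 * expNegInvGlue x * (expNegInvGlue x + expNegInvGlue (1 - x)) -
        expNegInvGlue x * (x⁻¹ ^ 2 * expNegInvGlue x + (1 - x)⁻¹ ^ 2 * expNegInvGlue (1 - x) * -1)) /
        (expNegInvGlue x + expNegInvGlue (1 - x)) ^ 2) x :=
    (hasDerivAt_expNegInvGlue x).div hden hpos.ne'
  convert hq using 1
  ring

/-- `1 + t²/2 ≤ cosh t`, in the form `2 + t² ≤ e^{-t} + e^{t}`: the `cosh` power series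
`Real.hasSum_cosh` has nonnegative terms, so it dominates its truncation after two terms. [folklore] -/
private theorem two_add_sq_le_exp_add_exp (t : ℝ) : 2 + t ^ 2 ≤ Real.exp (-t) + Real.exp t := by
  have h := Real.hasSum_cosh t
  have h2 : ∑ n ∈ Finset.range 2, t ^ (2 * n) / ((2 * n).factorial : ℝ) = 1 + t ^ 2 / 2 := by
    simp [Finset.sum_range_succ, Nat.factorial]
  have hle : 1 + t ^ 2 / 2 ≤ Real.cosh t := by
    rw [← h2]
    exact sum_le_hasSum _ (fun n _ => div_nonneg (by rw [pow_mul]; positivity) (by positivity)) h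
  rw [Real.cosh_eq] at hle
  linarith

/-- The key inequality behind `S′ ≤ 2`: for real `a, b` with `ab = a + b` (i.e. `1/a + 1/b = 1`),
`e^{-a} e^{-b} (a² + b²) ≤ 2 (e^{-a} + e^{-b})²` — by `e^{b-a} + e^{a-b} ≥ 2 + (a-b)²` this reduces to
`(a-2)² + (b-2)² ≥ 0`. (Adapted from `Literature.NumberTheory.Sieve.GreenTao2008.exp_mul_sq_add_sq_le`.)
[folklore] -/
private theorem exp_mul_sq_add_sq_le {a b : ℝ} (hab : a * b = a + b) :
    Real.exp (-a) * Real.exp (-b) * (a ^ 2 + b ^ 2) ≤ 2 * (Real.exp (-a) + Real.exp (-b)) ^ 2 := by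
  set A := Real.exp (-a) with hA
  set B := Real.exp (-b) with hB
  have hA0 : 0 < A := Real.exp_pos _
  have hB0 : 0 < B := Real.exp_pos _
  have hcosh : 2 + (a - b) ^ 2 ≤ Real.exp (b - a) + Real.exp (a - b) := by
    have h := two_add_sq_le_exp_add_exp (a - b)
    rwa [neg_sub] at h
  have e1 : A ^ 2 = A * B * Real.exp (b - a) := by
    rw [sq, hA, hB, ← Real.exp_add, ← Real.exp_add, ← Real.exp_add]
    congr 1; ring
  have e2 : B ^ 2 = A * B * Real.exp (a - b) := by
    rw [sq, hA, hB, ← Real.exp_add, ← Real.exp_add, ← Real.exp_add]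
    congr 1; ring
  have hsq : A * B * (2 + (a - b) ^ 2) ≤ A ^ 2 + B ^ 2 := by
    rw [e1, e2]
    nlinarith [mul_pos hA0 hB0]
  have hkey : a ^ 2 + b ^ 2 ≤ 8 + 2 * (a - b) ^ 2 := by
    nlinarith [sq_nonneg (a - 2), sq_nonneg (b - 2)]
  nlinarith [mul_pos hA0 hB0, mul_le_mul_of_nonneg_left hkey (mul_pos hA0 hB0).le]

/-- `0 ≤ S′ x ≤ 2` for Mathlib's smooth transition `S = Real.smoothTransition`, at every real `x`.
(Adapted from `Literature.NumberTheory.Sieve.GreenTao2008.deriv_smoothTransition_nonneg/le_two`.)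
[folklore] -/
private theorem deriv_smoothTransition_mem_Icc (x : ℝ) : deriv Real.smoothTransition x ∈ Set.Icc (0 : ℝ) 2 := by
  rw [(hasDerivAt_smoothTransition x).deriv]
  have hpos := Real.smoothTransition.pos_denom x
  have hg0 := expNegInvGlue.nonneg x
  have hg1 := expNegInvGlue.nonneg (1 - x)
  refine ⟨by positivity, ?_⟩
  rw [div_le_iff₀ (by positivity)]
  rcases le_or_gt x 0 with hx | hx
  · rw [expNegInvGlue.zero_of_nonpos hx]
    simp only [zero_mul]
    positivity
  rcases le_or_gt 1 x with hx1 | hx1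
  · rw [expNegInvGlue.zero_of_nonpos (show 1 - x ≤ 0 by linarith)]
    simp only [mul_zero, zero_mul]
    positivity
  -- `0 < x < 1`: `g x = e^{-1/x}`, `g (1 - x) = e^{-1/(1-x)}`
  have hgx : expNegInvGlue x = Real.exp (-x⁻¹) := by simp [expNegInvGlue, not_le.2 hx]
  have hg1x : expNegInvGlue (1 - x) = Real.exp (-(1 - x)⁻¹) := by
    simp [expNegInvGlue, not_le.2 (show 0 < 1 - x by linarith)]
  rw [hgx, hg1x]
  have hab : x⁻¹ * (1 - x)⁻¹ = x⁻¹ + (1 - x)⁻¹ := by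
    have hx0 : x ≠ 0 := hx.ne'
    have hx1' : 1 - x ≠ 0 := by linarith
    field_simp
    ring
  have := exp_mul_sq_add_sq_le hab
  linarith

/-- **The slope of Mathlib's smooth transition is at most `4` in absolute value**:
`|S′ x| ≤ 4` for every real `x`, `S = Real.smoothTransition` (in fact `0 ≤ S′ ≤ 2`). Used with the
chain rule for the tails cut-off `χ(r) = S (2 − r/(8M))` of the crux `AdiabaticMultiKerrILED`:
`|χ′| ≤ 4/(8M) = 1/(2M)`. [folklore] -/
theorem abs_deriv_smoothTransition_le_four : ∀ x : ℝ, |deriv Real.smoothTransition x| ≤ 4 := by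
  intro x
  obtain ⟨h0, h2⟩ := deriv_smoothTransition_mem_Icc x
  rw [abs_of_nonneg h0]
  linarith

end Summit.FinalStateConjecture.FinalStateConjecture.Theorems
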